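import Mathlib.Analysis.SpecialFunctions.Pow.Real
import HarnessLib

/-!
# The lacunary scales `M_k = a^{b^k}`, `N_k = M_k²`, `ℓ_k = N_{k+1}^{-1/3} N_k^{-2/3}` of the
# Coiculescu–Palasek construction (§2.4)

Analysis/FluidPDE support file (definitions with proved arithmetic; no named facts) on the discharge
path of the principal-parts hypothesis `hA` of
`Literature.Barriers.NavierStokesRegularity.CriticalDataSmoothNonuniqueness_of_principalParts_of_perturbationLe`
(M. P. Coiculescu, S. Palasek, *Non-uniqueness of smooth solutions of the Navier–Stokes equations from
critical data*, Invent. Math. 244 (2025), arXiv:2503.14699). **§2.4**: "The data and solutions we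
construct are active on two sequences of scales `M_k` and `N_k` which we take to be of the form
`M_k = ⌊A^{b^k}⌋`, `N_k = M_k ⌊M_k^{γ-1}⌋`, `k = 0, 1, 2, …` where `b > 5 ∨ 1/(1-8α)` and
`1/(1-4α) < γ < 1/(4α + b⁻¹)` can be chosen freely"; Def. 3.4: "a standard mollifier `φ_k` at length scale
`N_{k+1}^{-1/3} N_k^{-2/3}`"; throughout: "`N_k` is an integer multiple of `M_k`", "`N_{k+1}/N_k ≥ A^{γ(b-1)}`",
"`A` … taken to be as large as needed".

The formalisation makes the admissible choice `γ = 2` (inside the printed window as soon as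
`b > 2/(1-8α)`, since `1/(1-4α) < 2 < 1/(4α + b⁻¹)` then) with an INTEGER base `a ≥ 2` and an INTEGER
exponent `b ≥ 2`, so that no integer parts are needed: `M_k = a^{b^k}` and `N_k = M_k² = a^{2b^k}` are
natural numbers with `M_k ∣ N_k`, `M_{k+1} = M_k^b`, `N_{k+1} = N_k^b`. Proved here: these identities,
positivity and monotonicity, the lacunarity `N_{k+1} ≥ 2 N_k` (indeed `≥ N_k²`), `4 ≤ N_k`, and for the
mollification lengths `ℓ_k = N_{k+1}^{-1/3} N_k^{-2/3}`: `0 < ℓ_k ≤ 1/4`, `1 ≤ ℓ_k N_{k+1}`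
(`= (N_{k+1}/N_k)^{2/3}`), `ℓ_k N_k ≤ 1` — exactly the scale hypotheses of `CP25.IterData.Admissible`
(`MikadoDataIteration`).

## Mathlib / tree search

Mathlib: `Real.rpow`, `Real.rpow_natCast`, `Real.rpow_le_rpow_left_iff`, `Nat.pow_le_pow_left`.
`lean search 'scaleM|scaleN|lacunary.*scales|a \\^ b \\^ k'`: `CP25`-specific scales not in the tree
(the lacunary-sum file `LacunaryScaleSums` is stated for an arbitrary sequence with `N_{k+1} ≥ ρ N_k`).

## References

* M. P. Coiculescu, S. Palasek, Invent. Math. 244 (2025) 165–219, doi:10.1007/s00222-025-01396-z,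
  arXiv:2503.14699: §2.4 (parameters), Def. 3.4 (the mollification length), proof of Prop. 3.13
  (lacunarity `N_{k+1}/N_k ≥ A^{γ(b-1)}`). [CoiculescuPalasek2025]
-/

noncomputable section

open Real

namespace Literature.Analysis.FluidPDE

namespace CP25

/-! ## The scales -/

/-- **The profile scale `M_k = a^{b^k}`** (§2.4 with an integer base `a = A` and integer `b`, so that
`⌊A^{b^k}⌋ = A^{b^k}`). [cite: CoiculescuPalasek2025, §2.4] -/
def scaleM (a b k : ℕ) : ℕ := a ^ b ^ k

/-- **The oscillation scale `N_k = M_k²`** (§2.4 with `γ = 2`: `N_k = M_k ⌊M_k^{γ-1}⌋ = M_k · M_k`).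
[cite: CoiculescuPalasek2025, §2.4] -/
def scaleN (a b k : ℕ) : ℕ := scaleM a b k ^ 2

/-- **The mollification length `ℓ_k = N_{k+1}^{-1/3} N_k^{-2/3}`** (Def. 3.4).
[cite: CoiculescuPalasek2025, Def. 3.4] -/
def scaleL (a b k : ℕ) : ℝ :=
  ((scaleN a b (k + 1) : ℝ) ^ (-(1 / 3 : ℝ))) * ((scaleN a b k : ℝ) ^ (-(2 / 3 : ℝ)))

variable {a b : ℕ}

/-! ## Algebra of the integer scales -/

/-- `M_{k+1} = M_k^b`. [cite: CoiculescuPalasek2025, §2.4] -/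
theorem scaleM_succ (a b k : ℕ) : scaleM a b (k + 1) = scaleM a b k ^ b := by
  rw [scaleM, scaleM, pow_succ, pow_mul]

/-- `N_{k+1} = N_k^b`. [cite: CoiculescuPalasek2025, §2.4] -/
theorem scaleN_succ (a b k : ℕ) : scaleN a b (k + 1) = scaleN a b k ^ b := by
  rw [scaleN, scaleN, scaleM_succ, ← pow_mul, ← pow_mul, mul_comm]

/-- `N_k = M_k · M_k`: "`N_k` is an integer multiple of `M_k`". [cite: CoiculescuPalasek2025, §2.4] -/
theorem scaleN_eq_mul (a b k : ℕ) : scaleN a b k = scaleM a b k * scaleM a b k := by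
  rw [scaleN, sq]

/-- `M_k ∣ N_k`. [cite: CoiculescuPalasek2025, §2.4 ("`N_k` is an integer multiple of `M_k`")] -/
theorem scaleM_dvd_scaleN (a b k : ℕ) : scaleM a b k ∣ scaleN a b k :=
  ⟨scaleM a b k, scaleN_eq_mul a b k⟩

/-- `N_k / M_k = M_k`. [folklore] -/
theorem scaleN_div_scaleM (ha : 1 ≤ a) (b k : ℕ) : scaleN a b k / scaleM a b k = scaleM a b k := by
  have hM : 0 < scaleM a b k := pow_pos ha _
  rw [scaleN_eq_mul, Nat.mul_div_cancel _ hM]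

/-- `a ≤ M_k` (`b ≥ 1`). [folklore] -/
theorem le_scaleM (ha : 1 ≤ a) (hb : 1 ≤ b) (k : ℕ) : a ≤ scaleM a b k := by
  rw [scaleM]
  calc a = a ^ 1 := (pow_one a).symm
    _ ≤ a ^ b ^ k := Nat.pow_le_pow_right ha (Nat.one_le_pow _ _ hb)

/-- `1 ≤ M_k`. [folklore] -/
theorem one_le_scaleM (ha : 1 ≤ a) (b k : ℕ) : 1 ≤ scaleM a b k := Nat.one_le_pow _ _ ha

/-- `M_k ≤ N_k`. [cite: CoiculescuPalasek2025, §2.4 (`M_k ≲ N_k`)] -/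
theorem scaleM_le_scaleN (ha : 1 ≤ a) (b k : ℕ) : scaleM a b k ≤ scaleN a b k := by
  rw [scaleN_eq_mul]
  exact Nat.le_mul_of_pos_right _ (one_le_scaleM ha b k)

/-- `a² ≤ N_k`. [folklore] -/
theorem sq_le_scaleN (ha : 1 ≤ a) (hb : 1 ≤ b) (k : ℕ) : a ^ 2 ≤ scaleN a b k := by
  rw [scaleN]; exact Nat.pow_le_pow_left (le_scaleM ha hb k) 2

/-- `4 ≤ N_k` for `a ≥ 2`. [folklore] -/
theorem four_le_scaleN (ha : 2 ≤ a) (hb : 1 ≤ b) (k : ℕ) : 4 ≤ scaleN a b k :=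
  le_trans (by nlinarith : 4 ≤ a ^ 2) (sq_le_scaleN (le_trans one_le_two ha) hb k)

/-- `1 ≤ N_k`. [folklore] -/
theorem one_le_scaleN (ha : 1 ≤ a) (b k : ℕ) : 1 ≤ scaleN a b k := Nat.one_le_pow _ _ (one_le_scaleM ha b k)

/-- `0 < N_k`. [folklore] -/
theorem scaleN_pos (ha : 1 ≤ a) (b k : ℕ) : 0 < scaleN a b k := one_le_scaleN ha b k

/-- **Lacunarity**: `N_k² ≤ N_{k+1}` (`b ≥ 2`), so `N_{k+1}/N_k ≥ N_k ≥ a²`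
("`N_{k+1}/N_k = A^{γ(b^{k+1}-b^k)} ≥ A^{γ(b-1)}`"). [cite: CoiculescuPalasek2025, Prop. 3.13 (proof)] -/
theorem scaleN_sq_le_succ (ha : 1 ≤ a) (hb : 2 ≤ b) (k : ℕ) : scaleN a b k ^ 2 ≤ scaleN a b (k + 1) := by
  rw [scaleN_succ]
  exact Nat.pow_le_pow_right (one_le_scaleN ha b k) hb

/-- `N_k · N_k ≤ N_{k+1}`. [cite: CoiculescuPalasek2025, Prop. 3.13 (proof)] -/
theorem scaleN_mul_le_succ (ha : 1 ≤ a) (hb : 2 ≤ b) (k : ℕ) :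
    scaleN a b k * scaleN a b k ≤ scaleN a b (k + 1) := by
  rw [← sq]; exact scaleN_sq_le_succ ha hb k

/-- `2 N_k ≤ N_{k+1}` for `a ≥ 2`, `b ≥ 2` (the hypothesis of `LacunaryScaleSums`/`LacunarySmoothSeries`).
[cite: CoiculescuPalasek2025, Prop. 3.13 (proof)] -/
theorem two_mul_scaleN_le_succ (ha : 2 ≤ a) (hb : 2 ≤ b) (k : ℕ) : 2 * scaleN a b k ≤ scaleN a b (k + 1) := by
  have h4 := four_le_scaleN ha (le_trans one_le_two hb) k
  calc 2 * scaleN a b k ≤ scaleN a b k * scaleN a b k := Nat.mul_le_mul_right _ (by omega)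
    _ ≤ scaleN a b (k + 1) := scaleN_mul_le_succ (le_trans one_le_two ha) hb k

/-- `N_k ≤ N_{k+1}`. [folklore] -/
theorem scaleN_le_succ (ha : 2 ≤ a) (hb : 2 ≤ b) (k : ℕ) : scaleN a b k ≤ scaleN a b (k + 1) :=
  le_trans (Nat.le_mul_of_pos_left _ two_pos) (two_mul_scaleN_le_succ ha hb k)

/-- `N_k` is monotone in `k`. [folklore] -/
theorem scaleN_mono (ha : 2 ≤ a) (hb : 2 ≤ b) : Monotone (scaleN a b) :=
  monotone_nat_of_le_succ fun k => scaleN_le_succ ha hb k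

/-- `M_k ≤ M_{k+1}`. [folklore] -/
theorem scaleM_le_succ (ha : 1 ≤ a) (hb : 1 ≤ b) (k : ℕ) : scaleM a b k ≤ scaleM a b (k + 1) := by
  rw [scaleM_succ]
  calc scaleM a b k = scaleM a b k ^ 1 := (pow_one _).symm
    _ ≤ scaleM a b k ^ b := Nat.pow_le_pow_right (one_le_scaleM ha b k) hb

/-! ## The mollification lengths -/

section Lengths

variable (ha : 2 ≤ a) (hb : 2 ≤ b)
include ha hb

omit hb in
/-- `0 < ℓ_k`. [folklore] -/
theorem scaleL_pos (k : ℕ) : 0 < scaleL a b k := by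
  have h1 : (0 : ℝ) < scaleN a b (k + 1) := by exact_mod_cast scaleN_pos (le_trans one_le_two ha) b (k + 1)
  have h2 : (0 : ℝ) < scaleN a b k := by exact_mod_cast scaleN_pos (le_trans one_le_two ha) b k
  unfold scaleL
  exact mul_pos (rpow_pos_of_pos h1 _) (rpow_pos_of_pos h2 _)

omit hb in
/-- `x^{-1/3} x = x^{2/3}` and `x^{-2/3} x = x^{1/3}` for the positive reals `N_k`. [folklore] -/
theorem rpow_neg_third_mul (k : ℕ) :
    ((scaleN a b k : ℝ) ^ (-(1 / 3 : ℝ))) * scaleN a b k = (scaleN a b k : ℝ) ^ (2 / 3 : ℝ) ∧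
      ((scaleN a b k : ℝ) ^ (-(2 / 3 : ℝ))) * scaleN a b k = (scaleN a b k : ℝ) ^ (1 / 3 : ℝ) := by
  have h2 : (0 : ℝ) < scaleN a b k := by exact_mod_cast scaleN_pos (le_trans one_le_two ha) b k
  constructor
  · rw [← Real.rpow_add_one h2.ne']; norm_num
  · rw [← Real.rpow_add_one h2.ne']; norm_num

omit hb in
/-- **`ℓ_k N_{k+1} = N_{k+1}^{2/3} N_k^{-2/3}`**. [cite: CoiculescuPalasek2025, Def. 3.4] -/
theorem scaleL_mul_scaleN_succ (k : ℕ) :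
    scaleL a b k * scaleN a b (k + 1) =
      (scaleN a b (k + 1) : ℝ) ^ (2 / 3 : ℝ) * (scaleN a b k : ℝ) ^ (-(2 / 3 : ℝ)) := by
  have hx := (rpow_neg_third_mul ha (b := b) (k + 1)).1
  unfold scaleL
  calc (scaleN a b (k + 1) : ℝ) ^ (-(1 / 3 : ℝ)) * (scaleN a b k : ℝ) ^ (-(2 / 3 : ℝ)) * scaleN a b (k + 1)
      = ((scaleN a b (k + 1) : ℝ) ^ (-(1 / 3 : ℝ)) * scaleN a b (k + 1)) * (scaleN a b k : ℝ) ^ (-(2 / 3 : ℝ)) := by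
        ring
    _ = (scaleN a b (k + 1) : ℝ) ^ (2 / 3 : ℝ) * (scaleN a b k : ℝ) ^ (-(2 / 3 : ℝ)) := by rw [hx]

/-- **`1 ≤ ℓ_k N_{k+1}`** (`ℓ_k ≥ N_{k+1}⁻¹`: the hypothesis `ℓ_N` of `CP25.IterData.Admissible`; indeed
`ℓ_k N_{k+1} = (N_{k+1}/N_k)^{2/3} ≥ 1`). [cite: CoiculescuPalasek2025, Def. 3.4 with §2.4] -/
theorem one_le_scaleL_mul_scaleN_succ (k : ℕ) : 1 ≤ scaleL a b k * scaleN a b (k + 1) := by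
  rw [scaleL_mul_scaleN_succ ha k]
  have h2 : (0 : ℝ) < scaleN a b k := by exact_mod_cast scaleN_pos (le_trans one_le_two ha) b k
  have hle : (scaleN a b k : ℝ) ≤ scaleN a b (k + 1) := by exact_mod_cast scaleN_le_succ ha hb k
  -- `N_k^{2/3} N_k^{-2/3} = 1 ≤ N_{k+1}^{2/3} N_k^{-2/3}`
  have hone : (scaleN a b k : ℝ) ^ (2 / 3 : ℝ) * (scaleN a b k : ℝ) ^ (-(2 / 3 : ℝ)) = 1 := by
    rw [← rpow_add h2]; norm_num
  rw [← hone]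
  exact mul_le_mul_of_nonneg_right (rpow_le_rpow h2.le hle (by norm_num)) (rpow_nonneg h2.le _)

/-- **`ℓ_k N_k ≤ 1`**, indeed `ℓ_k N_k = (N_k/N_{k+1})^{1/3}` (the mollification length is below the
oscillation wavelength; "`(N_k/N_{k+1})^{1/3} = A^{-γ(b-1)b^k/3}`" in the proof of Prop. 3.7).
[cite: CoiculescuPalasek2025, Prop. 3.7 (proof, estimate of `I₂`)] -/
theorem scaleL_mul_scaleN_le_one (k : ℕ) : scaleL a b k * scaleN a b k ≤ 1 := by
  have h1 : (0 : ℝ) < scaleN a b (k + 1) := by exact_mod_cast scaleN_pos (le_trans one_le_two ha) b (k + 1)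
  have h2 : (0 : ℝ) < scaleN a b k := by exact_mod_cast scaleN_pos (le_trans one_le_two ha) b k
  have hle : (scaleN a b k : ℝ) ≤ scaleN a b (k + 1) := by exact_mod_cast scaleN_le_succ ha hb k
  have hy := (rpow_neg_third_mul ha (b := b) k).2
  unfold scaleL
  calc (scaleN a b (k + 1) : ℝ) ^ (-(1 / 3 : ℝ)) * (scaleN a b k : ℝ) ^ (-(2 / 3 : ℝ)) * scaleN a b k
      = (scaleN a b (k + 1) : ℝ) ^ (-(1 / 3 : ℝ)) * ((scaleN a b k : ℝ) ^ (-(2 / 3 : ℝ)) * scaleN a b k) := by ring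
    _ = (scaleN a b (k + 1) : ℝ) ^ (-(1 / 3 : ℝ)) * (scaleN a b k : ℝ) ^ (1 / 3 : ℝ) := by rw [hy]
    _ ≤ (scaleN a b k : ℝ) ^ (-(1 / 3 : ℝ)) * (scaleN a b k : ℝ) ^ (1 / 3 : ℝ) := by
        refine mul_le_mul_of_nonneg_right ?_ (rpow_nonneg h2.le _)
        exact rpow_le_rpow_of_nonpos h2 hle (by norm_num)
    _ = 1 := by rw [← rpow_add h2]; norm_num

/-- **`ℓ_k ≤ 1/4`** (`ℓ_k ≤ N_k⁻¹ ≤ 1/4`). [cite: CoiculescuPalasek2025, Def. 3.4] -/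
theorem scaleL_le_quarter (k : ℕ) : scaleL a b k ≤ 1 / 4 := by
  have h4 : (4 : ℝ) ≤ scaleN a b k := by exact_mod_cast four_le_scaleN ha (le_trans one_le_two hb) k
  have hpos := scaleL_pos ha (b := b) k
  have h := scaleL_mul_scaleN_le_one ha hb k
  nlinarith

/-- `ℓ_k ≤ 1`. [folklore] -/
theorem scaleL_le_one (k : ℕ) : scaleL a b k ≤ 1 := (scaleL_le_quarter ha hb k).trans (by norm_num)

end Lengths

/-! ## The window for `γ = 2` -/

/-- **The printed parameter window admits `γ = 2`**: for `0 < α < 1/8` and `b > 2/(1-8α)` one has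
`1/(1-4α) < 2 < 1/(4α + 1/b)` (§2.4: "`1/(1-4α) < γ < 1/(4α + b⁻¹)` can be chosen freely").
[cite: CoiculescuPalasek2025, §2.4] -/
theorem two_mem_gamma_window {α : ℝ} (hα : 0 < α) (hα' : α < 1 / 8) {b : ℝ} (hb : 2 / (1 - 8 * α) < b) :
    1 / (1 - 4 * α) < 2 ∧ (2 : ℝ) < 1 / (4 * α + 1 / b) := by
  have h1 : 0 < 1 - 8 * α := by linarith
  have hbpos : 0 < b := lt_trans (div_pos two_pos h1) hb
  refine ⟨?_, ?_⟩
  · rw [div_lt_iff₀ (by linarith)]; linarith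
  · have hb' : 1 / b < (1 - 8 * α) / 2 := by
      rw [div_lt_iff₀ hbpos]
      rw [div_lt_iff₀ h1] at hb
      linarith
    have hpos : 0 < 4 * α + 1 / b := by positivity
    rw [lt_div_iff₀ hpos]
    linarith

end CP25

end Literature.Analysis.FluidPDE
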